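import Summits.AnomalousDissipation.AnomalousDissipation.Theses.TaylorCertificates
import HarnessLib

/-!
# Route TaylorCertificates — the support `KolmogorovPairImpliesTarget`

Proof of the route declaration
`Summit.AnomalousDissipation.AnomalousDissipation.Theses.TaylorCertificates.KolmogorovPairImpliesTarget`
(item stmt-AnomalousDissipation-14184): the same-force coupling `KolmogorovFloorEnsembleCeiling`
(ONE smooth divergence-free mean-zero force carrying both the Kolmogorov-class floor certificate
and the ensemble ceiling) implies the route target `FloorCertificateEnsembleCeiling`.

This is pure logic: the target asks, for the same force `f` and the same constants `ε₀, E, ν₀`,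
for an *unrestricted* floor certificate `(Φ₁, θ₁)` with `θ₁ ≤ 0` plus the identical ensemble
ceiling; the hypothesis supplies, for every `ν ∈ (0, ν₀)`, a floor certificate that in addition
is band-limited (`fourierTruncate N (Φ₁.g i) = Φ₁.g i` with `N ≤ C ν^{-3/4}`) and has a weight
bounded below (`-Θ ≤ θ₁`). Forgetting `N`, the degree bound, the truncation identity and the lower
weight bound gives the target verbatim.
-/

namespace Summit.AnomalousDissipation.AnomalousDissipation.Theorems

-- the mandated namespace `Summit.<Summit>.<Problem>.Theorems` repeats `AnomalousDissipation` (single-problem summit)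
set_option linter.dupNamespace false

open Summit.AnomalousDissipation.AnomalousDissipation.Theses.TaylorCertificates

/-- **The Kolmogorov pair implies the target.** The same-force coupling
`KolmogorovFloorEnsembleCeiling` (Kolmogorov-class floor certificate AND ensemble ceiling for one
force) implies the route target `FloorCertificateEnsembleCeiling` (unrestricted floor certificate
AND ensemble ceiling for one force): keep the force `f`, the constants `ε₀, E, ν₀`, and for each
`ν ∈ (0, ν₀)` the certificate `(Φ₁, θ₁)` with `θ₁ ≤ 0`, its floor inequality and the ceiling;
discard the resolution `N`, the bound `N ≤ C ν^{-3/4}`, the band-limitation of the test fields and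
the lower weight bound `-Θ ≤ θ₁`. Closes item stmt-AnomalousDissipation-14184. -/
theorem KolmogorovPairImpliesTarget_proof :
    Summit.AnomalousDissipation.AnomalousDissipation.Theses.TaylorCertificates.KolmogorovPairImpliesTarget := by
  unfold KolmogorovPairImpliesTarget
  rintro ⟨f, hf₁, hf₂, hf₃, ε₀, _C, _Θ, E, ν₀, hε, hν₀, h⟩
  refine ⟨f, hf₁, hf₂, hf₃, ε₀, E, ν₀, hε, hν₀, fun ν hν hνν => ?_⟩
  obtain ⟨⟨_N, Φ₁, θ₁, -, -, -, hθ, hfloor⟩, hceil⟩ := h ν hν hνν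
  exact ⟨⟨Φ₁, θ₁, hθ, hfloor⟩, hceil⟩

end Summit.AnomalousDissipation.AnomalousDissipation.Theorems
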